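import Summits.BirchSwinnertonDyer.BirchSwinnertonDyer.Theorems.ManinLocalTwoThreeShimuraTwoCharOfPeriods
import Summits.BirchSwinnertonDyer.BirchSwinnertonDyer.Theorems.ManinLocalTwoThreeShimuraQuotientFourP
import Summits.BirchSwinnertonDyer.Rank1Residual.ManinAdditive.ShimuraKernel
import HarnessLib

/-!
# At `4 ∣ N`: no index `4` ⟹ the Shimura quotient has at most TWO classes ⟹ the period class of the optimal curve is a
# KRONECKER SYMBOL `(q | d_γ)` — so E-an-152b `ShimuraIndexNeFourAtFour` ⟹ «every optimal Shimura class at `4 ∣ N` is Kronecker»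
Summit `BirchSwinnertonDyer`, route `ManinLocalTwoThree` (cell bsd-f2-manin), deciding crux C2 `ManinOddAtFour` (stmt-BirchSwinnertonDyer-22967);
lead p1 gen 15.  Sequel to `…ShimuraTwoCharOfPeriods` (two classes ⟹ a representing Dirichlet character ⟹ `IsShimuraTwoChar` ⟹ Kronecker,
E-an-158 by name).  Here the missing lattice algebra for a LATTICE-OPTIMAL `X₀(N)`-datum (`Λ₀(f) = c₀⁻¹(ℤω₁ + ℤω₂)` has rank `2`):
* `exists_two_mul_add_rep_of_mem_periodLattice` — every period is `2w + (m₀ω₁ + n₀ω₂)/c₀` with `w ∈ Λ₀(f)`, `m₀, n₀ ∈ {0,1}`;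
* **`exists_two_classes_of_not_index_four`** — if `2Λ₀ ⊆ Λ₁` and `Λ₁ ≠ 2Λ₀` then for one `x₀ ∈ Λ₀`: every period is `≡ 0` or `≡ x₀
  (mod Λ₁)` (the three kinds of subgroups of `Λ₀/2Λ₀ ≅ (ℤ/2)²`: all of it, a line, or `0` = index `4`);
* **`exists_jacobiSym_represents_of_not_index_four`** — hence (`4 ∣ N`, lattice-optimal datum, `Λ₁(f) ≠ 2Λ₀(f)`): for one admissible squarefree
  `q ∣ N`, `{∞, γ∞}_f ∈ Λ₁(f) ⟺ (q | d_γ) = +1` for all `γ ∈ Γ₀(N)`;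
* **`exists_jacobiSym_represents_of_shimuraIndexNeFour`** — E-an-152b `ShimuraKernel.ShimuraIndexNeFourAtFour` ⟹ the same for EVERY
  lattice-optimal `X₀(N)`-datum at `4 ∣ N` (and unconditionally at the levels where E-an-152b is a theorem: `…ShimuraQuotientLevelInstances`).
HONEST FRAMING: structure theorems; nothing here decides which `q` or whether the class is trivial; C2, Manin's conjecture and BSD are NOT proved.
No definitions, no sorry.
[cite: LingOesterle1991, §1, Thm. 1 and Thm. 6] [cite: Stevens1989, §2]
-/

set_option autoImplicit false
-- the summit-side namespace `Summit.BirchSwinnertonDyer.BirchSwinnertonDyer.…` is the tree's (summit = sub-problem)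
set_option linter.dupNamespace false

noncomputable section

open scoped MatrixGroups ModularForm NumberTheorySymbols

open CongruenceSubgroup WeierstrassCurve Literature.NumberTheory.EllipticCurves
  Literature.NumberTheory.EllipticCurves.ModularForms
  Summit.BirchSwinnertonDyer.Rank1Residual.ManinAdditive
  Summit.BirchSwinnertonDyer.Rank1Residual.ManinAdditive.ShimuraKernel

namespace Summit.BirchSwinnertonDyer.BirchSwinnertonDyer.Theorems.ManinLocalTwoThree

variable {N : ℕ} [NeZero N] {W₀ : WeierstrassCurve ℚ}

/-- **Parity decomposition of a period.**  For a lattice-optimal `X₀(N)`-datum every `z ∈ Λ₀(f)` is `2w + (m₀ω₁ + n₀ω₂)/c₀` with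
`w ∈ Λ₀(f)` and `m₀, n₀ ∈ {0, 1}` (`c₀z = mω₁ + nω₂`, split `m, n` by parity). [cite: Stevens1989, §2] -/
theorem exists_two_mul_add_rep_of_mem_periodLattice (D₀ : ModularParametrizationData W₀ N)
    (h₀ : ∀ z ∈ D₀.L.lattice, ∃ w ∈ periodLattice D₀.f, z = D₀.c * w) {z : ℂ} (hz : z ∈ periodLattice D₀.f) :
    ∃ (m₀ n₀ : ℤ) (w : ℂ), (m₀ = 0 ∨ m₀ = 1) ∧ (n₀ = 0 ∨ n₀ = 1) ∧ w ∈ periodLattice D₀.f ∧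
      z = 2 * w + ((m₀ : ℂ) * (D₀.L.ω₁ / D₀.c) + (n₀ : ℂ) * (D₀.L.ω₂ / D₀.c)) := by
  have hc₀ : (D₀.c : ℂ) ≠ 0 := by exact_mod_cast D₀.maninConstant_ne_zero_holds
  obtain ⟨m, n, hmn⟩ := PeriodPair.mem_lattice.mp (D₀.smul_periodLattice_le z hz)
  have e₁ : D₀.L.ω₁ / (D₀.c : ℂ) ∈ periodLattice D₀.f :=
    div_maninConstant_mem_periodLattice_of_optimal D₀ h₀ D₀.L.ω₁_mem_lattice
  have e₂ : D₀.L.ω₂ / (D₀.c : ℂ) ∈ periodLattice D₀.f :=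
    div_maninConstant_mem_periodLattice_of_optimal D₀ h₀ D₀.L.ω₂_mem_lattice
  refine ⟨m % 2, n % 2, (m / 2 : ℤ) * (D₀.L.ω₁ / D₀.c) + (n / 2 : ℤ) * (D₀.L.ω₂ / D₀.c),
    by omega, by omega, ?_, ?_⟩
  · refine add_mem ?_ ?_
    · rw [← zsmul_eq_mul]; exact (periodLattice D₀.f).zsmul_mem e₁ _
    · rw [← zsmul_eq_mul]; exact (periodLattice D₀.f).zsmul_mem e₂ _
  · have hm : (m : ℂ) = 2 * ((m / 2 : ℤ) : ℂ) + ((m % 2 : ℤ) : ℂ) := by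
      exact_mod_cast (by omega : (m : ℤ) = 2 * (m / 2) + m % 2)
    have hn : (n : ℂ) = 2 * ((n / 2 : ℤ) : ℂ) + ((n % 2 : ℤ) : ℂ) := by
      exact_mod_cast (by omega : (n : ℤ) = 2 * (n / 2) + n % 2)
    have hz' : z = ((m : ℂ) * D₀.L.ω₁ + (n : ℂ) * D₀.L.ω₂) / D₀.c := by
      rw [hmn]; field_simp
    rw [hz', hm, hn]
    field_simp
    ring

/-- **No index `4` ⟹ at most two classes.**  For a lattice-optimal `X₀(N)`-datum with `2Λ₀(f) ⊆ Λ₁(f)` (e.g. `4 ∣ N`) and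
`Λ₁(f) ≠ 2Λ₀(f)`, there is `x₀ ∈ Λ₀(f)` with every period `≡ 0` or `≡ x₀ (mod Λ₁(f))`.  (Test the three half-classes
`ω₁/c₀, ω₂/c₀, (ω₁+ω₂)/c₀`: two in `Λ₁` ⟹ all, `Λ₁ = Λ₀`; exactly one ⟹ a line; none ⟹ `Λ₁ = 2Λ₀`, excluded.)
[cite: LingOesterle1991, Thm. 6] [cite: Stevens1989, §2] -/
theorem exists_two_classes_of_not_index_four (D₀ : ModularParametrizationData W₀ N)
    (h₀ : ∀ z ∈ D₀.L.lattice, ∃ w ∈ periodLattice D₀.f, z = D₀.c * w)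
    (h2 : ∀ z ∈ periodLattice D₀.f, (2 : ℂ) * z ∈ periodLatticeGamma1 D₀.f)
    (hne4 : ¬ (∀ z : ℂ, z ∈ periodLatticeGamma1 D₀.f ↔ ∃ w ∈ periodLattice D₀.f, z = 2 * w)) :
    ∃ x₀ ∈ periodLattice D₀.f, ∀ z ∈ periodLattice D₀.f,
      z ∈ periodLatticeGamma1 D₀.f ∨ z - x₀ ∈ periodLatticeGamma1 D₀.f := by
  set Λ₁ := periodLatticeGamma1 D₀.f with hΛ₁
  set e₁ := D₀.L.ω₁ / (D₀.c : ℂ) with he₁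
  set e₂ := D₀.L.ω₂ / (D₀.c : ℂ) with he₂
  have he₁Λ : e₁ ∈ periodLattice D₀.f := div_maninConstant_mem_periodLattice_of_optimal D₀ h₀ D₀.L.ω₁_mem_lattice
  have he₂Λ : e₂ ∈ periodLattice D₀.f := div_maninConstant_mem_periodLattice_of_optimal D₀ h₀ D₀.L.ω₂_mem_lattice
  have hΛ₁le : Λ₁ ≤ periodLattice D₀.f := periodLatticeGamma1_le_periodLattice D₀.f
  -- the representative of `z` modulo `2Λ₀`
  have hrep : ∀ z ∈ periodLattice D₀.f, ∃ r : ℂ, (r = 0 ∨ r = e₁ ∨ r = e₂ ∨ r = e₁ + e₂) ∧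
      (z - r ∈ Λ₁) ∧ (∃ w ∈ periodLattice D₀.f, z - r = 2 * w) := by
    intro z hz
    obtain ⟨m₀, n₀, w, hm₀, hn₀, hw, hzw⟩ := exists_two_mul_add_rep_of_mem_periodLattice D₀ h₀ hz
    refine ⟨(m₀ : ℂ) * e₁ + (n₀ : ℂ) * e₂, ?_, ?_, ⟨w, hw, by rw [hzw]; ring⟩⟩
    · rcases hm₀ with rfl | rfl <;> rcases hn₀ with rfl | rfl <;> simp
    · have e : z - ((m₀ : ℂ) * e₁ + (n₀ : ℂ) * e₂) = 2 * w := by rw [hzw]; ring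
      rw [e]; exact h2 w hw
  -- membership transfer along `z - r ∈ Λ₁`
  have iff_of_sub : ∀ {z r x : ℂ}, z - r ∈ Λ₁ → (z - x ∈ Λ₁ ↔ r - x ∈ Λ₁) := by
    intro z r x h
    constructor
    · intro h'; have := sub_mem h' h; convert this using 1; ring
    · intro h'; have := add_mem h h'; convert this using 1; ring
  by_cases b1 : e₁ ∈ Λ₁ <;> by_cases b2 : e₂ ∈ Λ₁
  · -- both in: `Λ₁ = Λ₀`
    refine ⟨0, zero_mem _, fun z hz ↦ Or.inl ?_⟩
    obtain ⟨r, hr, hzr, -⟩ := hrep z hz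
    have hrΛ : r ∈ Λ₁ := by
      rcases hr with rfl | rfl | rfl | rfl
      · exact zero_mem _
      · exact b1
      · exact b2
      · exact add_mem b1 b2
    simpa using add_mem hzr hrΛ
  · -- `e₁ ∈ Λ₁`, `e₂ ∉ Λ₁`: classes `{0, e₁}` and `{e₂, e₁ + e₂}`, `x₀ = e₂`
    refine ⟨e₂, he₂Λ, fun z hz ↦ ?_⟩
    obtain ⟨r, hr, hzr, -⟩ := hrep z hz
    rcases hr with rfl | rfl | rfl | rfl
    · left; simpa using hzr
    · left; simpa using add_mem hzr b1
    · right; exact (iff_of_sub hzr).mpr (by simp)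
    · right; exact (iff_of_sub hzr).mpr (by simpa using b1)
  · -- `e₂ ∈ Λ₁`, `e₁ ∉ Λ₁`: `x₀ = e₁`
    refine ⟨e₁, he₁Λ, fun z hz ↦ ?_⟩
    obtain ⟨r, hr, hzr, -⟩ := hrep z hz
    rcases hr with rfl | rfl | rfl | rfl
    · left; simpa using hzr
    · right; exact (iff_of_sub hzr).mpr (by simp)
    · left; simpa using add_mem hzr b2
    · right; exact (iff_of_sub hzr).mpr (by simpa using b2)
  · by_cases b3 : e₁ + e₂ ∈ Λ₁
    · -- `e₁ + e₂ ∈ Λ₁` only: classes `{0, e₁+e₂}` and `{e₁, e₂}`, `x₀ = e₁`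
      refine ⟨e₁, he₁Λ, fun z hz ↦ ?_⟩
      obtain ⟨r, hr, hzr, -⟩ := hrep z hz
      rcases hr with rfl | rfl | rfl | rfl
      · left; simpa using hzr
      · right; exact (iff_of_sub hzr).mpr (by simp)
      · right
        refine (iff_of_sub hzr).mpr ?_
        have : e₂ - e₁ = (e₁ + e₂) - 2 * e₁ := by ring
        rw [this]; exact sub_mem b3 (h2 e₁ he₁Λ)
      · left; simpa using add_mem hzr b3
    · -- none: `Λ₁ = 2Λ₀`, excluded
      exfalso
      apply hne4
      intro z
      constructor
      · intro hz1
        obtain ⟨r, hr, hzr, w, hw, hzw⟩ := hrep z (hΛ₁le hz1)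
        have hrΛ : r ∈ Λ₁ := by simpa using sub_mem hz1 hzr
        rcases hr with rfl | rfl | rfl | rfl
        · exact ⟨w, hw, by simpa using hzw⟩
        · exact absurd hrΛ b1
        · exact absurd hrΛ b2
        · exact absurd hrΛ b3
      · rintro ⟨w, hw, rfl⟩
        exact h2 w hw

/-- **No index `4` ⟹ the period class is a Kronecker symbol** (`4 ∣ N`, lattice-optimal `X₀(N)`-datum with `Λ₁(f) ≠ 2Λ₀(f)`): for one
admissible squarefree `q ∣ N` (odd unless `32 ∣ N`, `≡ 1 (mod 4)` unless `8 ∣ N`), `{∞, γ∞}_f ∈ Λ₁(f) ⟺ (q | d_γ) = +1` for every `γ ∈ Γ₀(N)`.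
[cite: LingOesterle1991, §1, Thm. 1 and Thm. 6] [cite: Stevens1989, §2] -/
theorem exists_jacobiSym_represents_of_not_index_four (D₀ : ModularParametrizationData W₀ N)
    (h₀ : ∀ z ∈ D₀.L.lattice, ∃ w ∈ periodLattice D₀.f, z = D₀.c * w) (h4 : 2 ^ 2 ∣ N)
    (hne4 : ¬ (∀ z : ℂ, z ∈ periodLatticeGamma1 D₀.f ↔ ∃ w ∈ periodLattice D₀.f, z = 2 * w)) :
    ∃ q : ℕ, Squarefree q ∧ q ∣ N ∧ (¬ 32 ∣ N → Odd q) ∧ (¬ 8 ∣ N → q % 4 = 1) ∧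
      ∀ γ : Gamma0 N, cuspSymbol D₀.f γ ∈ periodLatticeGamma1 D₀.f ↔
        J(q | (((γ : SL(2, ℤ)) 1 1 : ℤ)).natAbs) = 1 := by
  have h2 : ∀ z ∈ periodLattice D₀.f, (2 : ℂ) * z ∈ periodLatticeGamma1 D₀.f := fun z hz ↦ by
    have h := pMulLatticeLeGamma1OfTracelessPrime_holds N D₀.f D₀.isNewformOf.1 2 Nat.prime_two
      ((dvd_pow_self 2 two_ne_zero).trans h4) (D₀.isNewformOf.1.cuspCoeff_eq_zero_of_sq_dvd Nat.prime_two h4) z hz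
    exact_mod_cast h
  obtain ⟨x₀, hx₀, htwo⟩ := exists_two_classes_of_not_index_four D₀ h₀ h2 hne4
  exact exists_jacobiSym_represents_of_two_classes D₀.f (by simpa using h4) (h2 x₀ hx₀) htwo

/-- **E-an-152b ⟹ every optimal Shimura class at `4 ∣ N` is a Kronecker symbol**: under `ShimuraKernel.ShimuraIndexNeFourAtFour`, for
every globally minimal `W₀` and every lattice-optimal `X₀(N)`-datum with `4 ∣ N` there is an admissible squarefree `q ∣ N` with
`{∞, γ∞}_f ∈ Λ₁(f) ⟺ (q | d_γ) = +1`.  CONDITIONAL on E-an-152b (OPEN in general; a theorem at the levels of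
`…ShimuraQuotientLevelInstances`). [cite: LingOesterle1991, §1, Thm. 1 and Thm. 6] -/
theorem exists_jacobiSym_represents_of_shimuraIndexNeFour (h152b : ShimuraIndexNeFourAtFour)
    {W₀ : WeierstrassCurve ℚ} [W₀.IsElliptic] [W₀.IsGloballyMinimal] (D₀ : ModularParametrizationData W₀ N)
    (h₀ : ∀ z ∈ D₀.L.lattice, ∃ w ∈ periodLattice D₀.f, z = D₀.c * w) (h4 : 2 ^ 2 ∣ N) :
    ∃ q : ℕ, Squarefree q ∧ q ∣ N ∧ (¬ 32 ∣ N → Odd q) ∧ (¬ 8 ∣ N → q % 4 = 1) ∧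
      ∀ γ : Gamma0 N, cuspSymbol D₀.f γ ∈ periodLatticeGamma1 D₀.f ↔
        J(q | (((γ : SL(2, ℤ)) 1 1 : ℤ)).natAbs) = 1 :=
  exists_jacobiSym_represents_of_not_index_four D₀ h₀ h4 (h152b W₀ D₀ h₀ h4)

end Summit.BirchSwinnertonDyer.BirchSwinnertonDyer.Theorems.ManinLocalTwoThree

end
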